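import Summits.BirchSwinnertonDyer.Rank1Residual.X5.TwoAdicInstancesMultAnchorsS
import Summits.BirchSwinnertonDyer.Rank1Residual.X5.TwoAdicInstances144027d
import Summits.BirchSwinnertonDyer.Rank1Residual.X5.TwoAdicInstancesToolkitC
import Summits.BirchSwinnertonDyer.Rank1Residual.X5.TwoAdicInstancesToolkitD
import HarnessLib

/-!
# X5 at `p = 2` (cell `bsd-2adic`, seat `bsd-2adic-t42`, GEN 7): NON-SPLIT ANCHORS `178b1`, `222c1` for DOOR (34-GV-mult) — curve data only

HONEST FRAMING (cell `bsd-2adic`, run/shared/lean/pub/bsd-2adic/, HUMAN RULINGS D-0036 / D-0054): research route; NO door theorem,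
nothing displayed, nothing booked; BSD is not proved by any of this. PARTITION: X5@2 multiplicative (K4ᵐ, RESIDUAL-MAP B1·O1;
tranche 1 of the GV-mult habitat) × p = 2 — types-the-object-of (anchor curves for the congruence transport; closes none).
WHAT: the non-split multiplicative ANCHORS (`2 ∥ N`, `r = 0`, exactly one rational `2`-torsion point, of Greenberg type A or B) that the
tranche-1 classes of HOME/t42/DESIGN-T42-ADDENDUM-8.md need and that are NOT in the mult lane's anchors files
`X5/TwoAdicInstancesMultAnchors{A,B,C,S}.lean` (one writer per object: those files are imported elsewhere, never edited; planner word
2026-08-27T03:25:10Z (A) «if a class needs a NEW anchor, add it in a t42 anchors file»). Per anchor, DECIDED BY THE KERNEL: minimality,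
ellipticity, NON-SPLIT multiplicative reduction at `2`, the conductor (squarefree: coprimality; additive `3`: Rizzo's Table II in the kernel;
additive `ℓ ≥ 5`: `f = 2`), the unique rational `2`-torsion point and its Greenberg type, `2 ∣ #Ẽ(𝔽_ℓ)` at good odd `ℓ`. The anchors'
λ-invariant enters the doors ONLY through the displayed certificate binders `hlanA : λ_an(A) = 0`, `hμanA` of the class files (rows:
engine-1 GVM-law kit j244761 `mult/step0/GVM-law-p5.out` (178b1, 222c1: (μ,λ)_an = (0,0), LAW PASS, MU0 YES), engine-2 kit j248630 control rows (OK)) — EVIDENCE, never facts. Emitter: HOME/t42/gen/gen_anchorsfile.py + memberdata.py (port of the mult lane's genlaw5.py member block).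
WHAT THIS IS NOT: not a door, not a certificate, not a discharge of anything.

References: [SilvermanAEC2009] VII.1, VII.3.1, VII.5.1, III.1–III.2; [Silverman1994] IV.10.2; [GreenbergLNM1716] §5, Prop. 5.14;
[GreenbergVatsal2000] p. 4 (anchors); [CremonaAlgorithms1997] Table 1 (178b1, 222c1); [Rizzo2003] Table II.
-/

set_option autoImplicit false

open IsDedekindDomain WeierstrassCurve Literature.NumberTheory.EllipticCurves
  Literature.NumberTheory.EllipticCurves.ModularForms
  Literature.NumberTheory.EllipticCurves.Rank1Residual
  Literature.NumberTheory.EllipticCurves.Rank1Residual.Typed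
  Literature.NumberTheory.EllipticCurves.Greenberg1999
  Literature.NumberTheory.EllipticCurves.PolyCert
  Literature.NumberTheory.EllipticCurves.Rank1Residual.X11RankOneCertificates
  Summit.BirchSwinnertonDyer.Rank1Residual.X1.MuPart
  Summit.BirchSwinnertonDyer.Rank1Residual.X1.ParitySqueeze
  Summit.BirchSwinnertonDyer.Rank1Residual.X5.O1

open CongruenceSubgroup
open scoped MatrixGroups ModularForm

namespace Summit.BirchSwinnertonDyer.Rank1Residual.X5.Instances

/-! ## Anchor `178b1` (`N = 178`, non-split at `2`, type B, `x(P) = -8`) -/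

/-- Cremona `178b1` = `[1, 1, 0, -44, 80]` (integer model). [cite: CremonaAlgorithms1997, Table 1] -/
abbrev M178b1 : WeierstrassCurve ℤ := ⟨1, 1, 0, -44, 80⟩
/-- `178b1 / ℚ`. [cite: CremonaAlgorithms1997, Table 1] -/
abbrev c178b1 : WeierstrassCurve ℚ := M178b1.baseChange ℚ
/-- `Δ(178b1) = 2^14·89`. [cite: CremonaAlgorithms1997, Table 1] -/
theorem M178b1_Δ : M178b1.Δ = 1458176 := by decide
/-- `c₄(178b1)` (`|c₄| = 2137`). [cite: CremonaAlgorithms1997, Table 1] -/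
theorem M178b1_c₄ : M178b1.c₄ = 2137 := by decide
/-- `178b1` is an elliptic curve. [cite: CremonaAlgorithms1997, Table 1] -/
instance c178b1_isElliptic : c178b1.IsElliptic := by
  rw [WeierstrassCurve.isElliptic_iff, baseChange_int_Δ, M178b1_Δ]; norm_num
/-- Cremona's model `178b1` is globally minimal (`gcd(Δ, c₄) = 1`). [cite: SilvermanAEC2009, VII.1 Remark 1.1] -/
instance c178b1_isGloballyMinimal : c178b1.IsGloballyMinimal :=
  isGloballyMinimal_baseChange_int_of_gcd_eq_one 1 1 0 (-44) 80 (by decide)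
/-- **`178b1` is multiplicative at `2`** (`2 ∣ Δ`, `2 ∤ c₄`). [cite: SilvermanAEC2009, VII.5 Prop. 5.1(b)] -/
theorem mult_two_178b1 : Mult c178b1 2 := by
  have hgen : Rat.HeightOneSpectrum.natGenerator
      ((Rat.HeightOneSpectrum.primesEquiv (R := ℤ)).symm ⟨2, Nat.prime_two⟩) = 2 :=
    Literature.NumberTheory.EllipticCurves.Rat.natGenerator_primesEquiv_symm ⟨2, Nat.prime_two⟩
  have hm : c178b1.HasMultiplicativeReductionAt
      ((Rat.HeightOneSpectrum.primesEquiv (R := ℤ)).symm ⟨2, Nat.prime_two⟩) := by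
    refine hasMultiplicativeReductionAt_of_valuation_c₄_eq_one (isIntegralAt_baseChange _ M178b1) ?_ ?_
    · rw [baseChange_int_c₄, Literature.NumberTheory.EllipticCurves.Rat.valuation_intCast_eq_one_iff, hgen,
        M178b1_c₄]; decide
    · rw [baseChange_int_Δ, Literature.NumberTheory.EllipticCurves.Rat.valuation_intCast_lt_one_iff, hgen,
        M178b1_Δ]; decide
  exact (hasMultiplicativeReductionAtPrime_iff_hasMultiplicativeReductionAt_holds c178b1
    ⟨2, Nat.prime_two⟩).mpr hm
/-- `178b1 mod 2`. [folklore] -/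
theorem M178b1_mod_two : M178b1.map (Int.castRingHom (ZMod 2)) = ⟨1, 1, 0, 0, 0⟩ := by
  ext <;> decide
/-- **`178b1` is NON-SPLIT multiplicative at `2`** (the node quadratic `X² + X + 1` has no root in `𝔽₂`). [cite: SilvermanAEC2009, VII.5 Prop. 5.1(b)] -/
theorem not_split_two_178b1 : ¬ c178b1.HasSplitMultiplicativeReductionAtPrime 2 := by
  have hint : integralModelInt c178b1 = M178b1 := integralModelInt_baseChange_int M178b1
  have hΔ : ((2 : ℕ) : ℤ) ∣ (integralModelInt c178b1).Δ := by rw [hint, M178b1_Δ]; decide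
  have hc₄ : ¬ ((2 : ℕ) : ℤ) ∣ (integralModelInt c178b1).c₄ := by rw [hint, M178b1_c₄]; decide
  rw [LocalTorsionMult.hasSplitMultiplicativeReductionAtPrime_iff_splits_integralModelInt c178b1 2 hΔ
    hc₄, hint, M178b1_mod_two]
  dsimp only
  rw [sub_eq_add_neg, ← Polynomial.C_neg]
  exact not_splits_quadratic_F2 (by decide) (by decide) (by decide)
/-- `Δ(178b1)`, `c₄(178b1)` coprime (semistable model). [cite: SilvermanAEC2009, VII.5 Prop. 5.1(b)] -/
theorem M178b1_coprime : IsCoprime M178b1.Δ M178b1.c₄ := by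
  rw [M178b1_Δ, M178b1_c₄, Int.isCoprime_iff_gcd_eq_one]; decide
/-- **The conductor of `178b1` is `178`** (semistable: the radical of `Δ`; Silverman ATAEC IV.10.2). [cite: CremonaAlgorithms1997, Table 1] [cite: Silverman1994, IV.10.2] -/
theorem conductorNorm_178b1 : c178b1.conductorNorm ℤ = 178 := by
  refine conductorNorm_baseChange_int_of_isCoprime M178b1 M178b1_coprime (k := 14) ?_ ?_ ?_
  · rw [Nat.squarefree_iff_nodup_primeFactorsList (by norm_num)]; simp
  · rw [M178b1_Δ]; decide
  · rw [M178b1_Δ]; decide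

/-- The coefficients of `178b1 / ℚ` (unfolded). [cite: CremonaAlgorithms1997, Table 1] -/
theorem c178b1_eq : c178b1 = ⟨1, 1, 0, -44, 80⟩ := by
  rw [c178b1, baseChange_int_eq]; norm_num
/-- `b₂, b₄, b₆` of `178b1`; `2`-division cubic `= (x − (-8))(4x² + ((-27))x + (40))`. [cite: SilvermanAEC2009, III.1] -/
theorem c178b1_b : c178b1.b₂ = 5 ∧ c178b1.b₄ = -88 ∧ c178b1.b₆ = 320 := by
  rw [c178b1_eq]
  simp only [WeierstrassCurve.b₂, WeierstrassCurve.b₄, WeierstrassCurve.b₆]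
  norm_num
/-- The rational point `(-8, 4)` of order `2` on `178b1`. [cite: CremonaAlgorithms1997, Table 1] -/
theorem c178b1_P : c178b1.toAffine.Equation (-8) 4 ∧
    2 * (4 : ℚ) + c178b1.a₁ * (-8) + c178b1.a₃ = 0 := by
  rw [c178b1_eq, WeierstrassCurve.Affine.equation_iff]; norm_num
/-- **`(-8, 4)` is the ONLY rational point of order `2` on `178b1`** (the cofactor `4x² + ((-27))x + (40)` has non-square discriminant). [cite: SilvermanAEC2009, III.2.3] -/
theorem c178b1_unique : HasUniqueRationalTwoTorsionX c178b1 (-8) := by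
  refine ⟨⟨4, c178b1_P⟩, fun z hz ↦ ?_⟩
  have hc := cubic_eq_zero_of_hasRationalTwoTorsionX hz
  obtain ⟨hb₂, hb₄, hb₆⟩ := c178b1_b
  rw [hb₂, hb₄, hb₆] at hc
  have hfac : (z - (-8)) * (4 * z ^ 2 + (-27) * z + 40) = 0 := by linear_combination hc
  exact eq_of_cubic_factor_of_not_isSquare z hfac (by norm_num)
/-- **`(-8, 4)` is "odd"**: the least real root of the `2`-division cubic. [cite: GreenbergLNM1716, §5 Remark (chunk p0174)] -/
theorem c178b1_odd : TwoTorsionOdd c178b1 (-8) := by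
  intro r hr
  obtain ⟨hb₂, hb₄, hb₆⟩ := c178b1_b
  rw [hb₂, hb₄, hb₆] at hr
  push_cast at hr
  have hfac : (r - (-8)) * (4 * r ^ 2 + (-27) * r + 40) = 0 := by linear_combination hr
  have := le_of_cubic_factor_of_lt r hfac (by norm_num) (by norm_num)
  push_cast; linarith
/-- **`(-8, 4)` is of Greenberg type B** (odd, not ramified at `2`: `-8 ∈ ℤ`). [cite: GreenbergLNM1716, Prop. 5.14 (p. 171)] -/
theorem c178b1_typeAB : (TwoTorsionRamifiedAtTwo ((-8) : ℚ) ∧ ¬ TwoTorsionOdd c178b1 (-8)) ∨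
    (TwoTorsionOdd c178b1 (-8) ∧ ¬ TwoTorsionRamifiedAtTwo ((-8) : ℚ)) :=
  Or.inr ⟨c178b1_odd, by simpa using not_twoTorsionRamifiedAtTwo_intCast (-8)⟩

/-- `2 ∣ #Ẽ(𝔽_ℓ)` for `178b1` at every good odd prime `ℓ` (a rational `2`-torsion point). [cite: SilvermanAEC2009, VII.3.1(b)] -/
theorem two_dvd_reductionPointCount_178b1 {ℓ : ℕ} [Fact ℓ.Prime] (hℓ : 3 ≤ ℓ)
    (hΔ : ¬ (ℓ : ℤ) ∣ (1458176 : ℤ)) : 2 ∣ c178b1.reductionPointCount ℓ :=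
  two_dvd_reductionPointCount_of_hasRationalTwoTorsionX ⟨4, c178b1_P⟩ hℓ
    (by rw [minimalDiscriminantInt_baseChange_int, M178b1_Δ]; exact hΔ)

/-! ## Anchor `222c1` (`N = 222`, non-split at `2`, type B, `x(P) = 0`) -/

/-- Cremona `222c1` = `[1, 1, 0, 16, 0]` (integer model). [cite: CremonaAlgorithms1997, Table 1] -/
abbrev M222c1 : WeierstrassCurve ℤ := ⟨1, 1, 0, 16, 0⟩
/-- `222c1 / ℚ`. [cite: CremonaAlgorithms1997, Table 1] -/
abbrev c222c1 : WeierstrassCurve ℚ := M222c1.baseChange ℚ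
/-- `Δ(222c1) = −2^8·3^3·37`. [cite: CremonaAlgorithms1997, Table 1] -/
theorem M222c1_Δ : M222c1.Δ = -255744 := by decide
/-- `c₄(222c1)` (`|c₄| = 743`). [cite: CremonaAlgorithms1997, Table 1] -/
theorem M222c1_c₄ : M222c1.c₄ = -743 := by decide
/-- `222c1` is an elliptic curve. [cite: CremonaAlgorithms1997, Table 1] -/
instance c222c1_isElliptic : c222c1.IsElliptic := by
  rw [WeierstrassCurve.isElliptic_iff, baseChange_int_Δ, M222c1_Δ]; norm_num
/-- Cremona's model `222c1` is globally minimal (`gcd(Δ, c₄) = 1`). [cite: SilvermanAEC2009, VII.1 Remark 1.1] -/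
instance c222c1_isGloballyMinimal : c222c1.IsGloballyMinimal :=
  isGloballyMinimal_baseChange_int_of_gcd_eq_one 1 1 0 16 0 (by decide)
/-- **`222c1` is multiplicative at `2`** (`2 ∣ Δ`, `2 ∤ c₄`). [cite: SilvermanAEC2009, VII.5 Prop. 5.1(b)] -/
theorem mult_two_222c1 : Mult c222c1 2 := by
  have hgen : Rat.HeightOneSpectrum.natGenerator
      ((Rat.HeightOneSpectrum.primesEquiv (R := ℤ)).symm ⟨2, Nat.prime_two⟩) = 2 :=
    Literature.NumberTheory.EllipticCurves.Rat.natGenerator_primesEquiv_symm ⟨2, Nat.prime_two⟩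
  have hm : c222c1.HasMultiplicativeReductionAt
      ((Rat.HeightOneSpectrum.primesEquiv (R := ℤ)).symm ⟨2, Nat.prime_two⟩) := by
    refine hasMultiplicativeReductionAt_of_valuation_c₄_eq_one (isIntegralAt_baseChange _ M222c1) ?_ ?_
    · rw [baseChange_int_c₄, Literature.NumberTheory.EllipticCurves.Rat.valuation_intCast_eq_one_iff, hgen,
        M222c1_c₄]; decide
    · rw [baseChange_int_Δ, Literature.NumberTheory.EllipticCurves.Rat.valuation_intCast_lt_one_iff, hgen,
        M222c1_Δ]; decide
  exact (hasMultiplicativeReductionAtPrime_iff_hasMultiplicativeReductionAt_holds c222c1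
    ⟨2, Nat.prime_two⟩).mpr hm
/-- `222c1 mod 2`. [folklore] -/
theorem M222c1_mod_two : M222c1.map (Int.castRingHom (ZMod 2)) = ⟨1, 1, 0, 0, 0⟩ := by
  ext <;> decide
/-- **`222c1` is NON-SPLIT multiplicative at `2`** (the node quadratic `X² + X + 1` has no root in `𝔽₂`). [cite: SilvermanAEC2009, VII.5 Prop. 5.1(b)] -/
theorem not_split_two_222c1 : ¬ c222c1.HasSplitMultiplicativeReductionAtPrime 2 := by
  have hint : integralModelInt c222c1 = M222c1 := integralModelInt_baseChange_int M222c1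
  have hΔ : ((2 : ℕ) : ℤ) ∣ (integralModelInt c222c1).Δ := by rw [hint, M222c1_Δ]; decide
  have hc₄ : ¬ ((2 : ℕ) : ℤ) ∣ (integralModelInt c222c1).c₄ := by rw [hint, M222c1_c₄]; decide
  rw [LocalTorsionMult.hasSplitMultiplicativeReductionAtPrime_iff_splits_integralModelInt c222c1 2 hΔ
    hc₄, hint, M222c1_mod_two]
  dsimp only
  rw [sub_eq_add_neg, ← Polynomial.C_neg]
  exact not_splits_quadratic_F2 (by decide) (by decide) (by decide)
/-- `Δ(222c1)`, `c₄(222c1)` coprime (semistable model). [cite: SilvermanAEC2009, VII.5 Prop. 5.1(b)] -/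
theorem M222c1_coprime : IsCoprime M222c1.Δ M222c1.c₄ := by
  rw [M222c1_Δ, M222c1_c₄, Int.isCoprime_iff_gcd_eq_one]; decide
/-- **The conductor of `222c1` is `222`** (semistable: the radical of `Δ`; Silverman ATAEC IV.10.2). [cite: CremonaAlgorithms1997, Table 1] [cite: Silverman1994, IV.10.2] -/
theorem conductorNorm_222c1 : c222c1.conductorNorm ℤ = 222 := by
  refine conductorNorm_baseChange_int_of_isCoprime M222c1 M222c1_coprime (k := 8) ?_ ?_ ?_
  · rw [Nat.squarefree_iff_nodup_primeFactorsList (by norm_num)]; simp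
  · rw [M222c1_Δ]; decide
  · rw [M222c1_Δ]; decide

/-- The coefficients of `222c1 / ℚ` (unfolded). [cite: CremonaAlgorithms1997, Table 1] -/
theorem c222c1_eq : c222c1 = ⟨1, 1, 0, 16, 0⟩ := by
  rw [c222c1, baseChange_int_eq]; norm_num
/-- `b₂, b₄, b₆` of `222c1`; `2`-division cubic `= (x − 0)(4x² + (5)x + (64))`. [cite: SilvermanAEC2009, III.1] -/
theorem c222c1_b : c222c1.b₂ = 5 ∧ c222c1.b₄ = 32 ∧ c222c1.b₆ = 0 := by
  rw [c222c1_eq]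
  simp only [WeierstrassCurve.b₂, WeierstrassCurve.b₄, WeierstrassCurve.b₆]
  norm_num
/-- The rational point `(0, 0)` of order `2` on `222c1`. [cite: CremonaAlgorithms1997, Table 1] -/
theorem c222c1_P : c222c1.toAffine.Equation 0 0 ∧
    2 * (0 : ℚ) + c222c1.a₁ * 0 + c222c1.a₃ = 0 := by
  rw [c222c1_eq, WeierstrassCurve.Affine.equation_iff]; norm_num
/-- **`(0, 0)` is the ONLY rational point of order `2` on `222c1`** (the cofactor `4x² + (5)x + (64)` has negative discriminant). [cite: SilvermanAEC2009, III.2.3] -/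
theorem c222c1_unique : HasUniqueRationalTwoTorsionX c222c1 0 := by
  refine ⟨⟨0, c222c1_P⟩, fun z hz ↦ ?_⟩
  have hc := cubic_eq_zero_of_hasRationalTwoTorsionX hz
  obtain ⟨hb₂, hb₄, hb₆⟩ := c222c1_b
  rw [hb₂, hb₄, hb₆] at hc
  have hfac : (z - 0) * (4 * z ^ 2 + 5 * z + 64) = 0 := by linear_combination hc
  rcases mul_eq_zero.mp hfac with h | h
  · linarith
  · nlinarith [sq_nonneg (8 * z + 5)]
/-- **`(0, 0)` is "odd"**: the only real root of the `2`-division cubic. [cite: GreenbergLNM1716, §5 Remark (chunk p0174)] -/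
theorem c222c1_odd : TwoTorsionOdd c222c1 0 := by
  intro r hr
  obtain ⟨hb₂, hb₄, hb₆⟩ := c222c1_b
  rw [hb₂, hb₄, hb₆] at hr
  push_cast at hr
  have hfac : (r - 0) * (4 * r ^ 2 + 5 * r + 64) = 0 := by linear_combination hr
  rcases mul_eq_zero.mp hfac with h | h
  · push_cast; linarith
  · nlinarith [sq_nonneg (8 * r + 5)]
/-- **`(0, 0)` is of Greenberg type B** (odd, not ramified at `2`: `0 ∈ ℤ`). [cite: GreenbergLNM1716, Prop. 5.14 (p. 171)] -/
theorem c222c1_typeAB : (TwoTorsionRamifiedAtTwo (0 : ℚ) ∧ ¬ TwoTorsionOdd c222c1 0) ∨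
    (TwoTorsionOdd c222c1 0 ∧ ¬ TwoTorsionRamifiedAtTwo (0 : ℚ)) :=
  Or.inr ⟨c222c1_odd, by simpa using not_twoTorsionRamifiedAtTwo_intCast 0⟩

/-- `2 ∣ #Ẽ(𝔽_ℓ)` for `222c1` at every good odd prime `ℓ` (a rational `2`-torsion point). [cite: SilvermanAEC2009, VII.3.1(b)] -/
theorem two_dvd_reductionPointCount_222c1 {ℓ : ℕ} [Fact ℓ.Prime] (hℓ : 3 ≤ ℓ)
    (hΔ : ¬ (ℓ : ℤ) ∣ (-255744 : ℤ)) : 2 ∣ c222c1.reductionPointCount ℓ :=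
  two_dvd_reductionPointCount_of_hasRationalTwoTorsionX ⟨0, c222c1_P⟩ hℓ
    (by rw [minimalDiscriminantInt_baseChange_int, M222c1_Δ]; exact hΔ)

end Summit.BirchSwinnertonDyer.Rank1Residual.X5.Instances
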